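import Literature.IUT.HodgeTheaters.PMBaseBridgePropsProofs9
import Literature.IUT.HodgeTheaters.PMBaseEx63Proofs

/-!
# Proofs over [IUTchI] Props 6.6 (ii), (iii), 6.8 (i) from the `[−1]`-compatibility of `φ^{Θell}_{•,v}`

Mochizuki, *Inter-universal Teichmüller theory I*, §6, Props 6.6 (ii), (iii) p. 165, 6.8 (i) p. 168,
kurims manuscript (May 2020). PROOF-ONLY companion (theorems, no definitions) to abc-iut-L5-t4's
`PMBaseBridgeProps.lean` / `PMBaseProcessions.lean`, by the L5 discharge seat abc-iut-L5-t13: the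
conditional discharges of `…Proofs5` / `…Proofs9` restated over the single kit-shaped condition of
`PMBaseEx63Proofs` (a negative automorphism of each `𝒟_v` intertwined by `φ^{Θell}_{•,v}` with a lift of
`(0, −1)`), via `Ex63.equivariant_of_negCompat`.
Record only; [claim: Mochizuki2012, status: disputed]; nothing here takes a side on any disputed step.
-/

namespace Literature.IUT.HodgeTheaters

open CategoryTheory

universe u

namespace PMBaseKit

variable {l : ℕ} {K : PMBaseKit.{u} l}

/-- **[IUTchI] Prop 6.6 (ii) — PROVED** given the `[−1]`-compatibility of `φ^{Θell}_{•,v}`.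
[claim: Mochizuki2012, status: disputed] -/
theorem DThetaEllBridge.isoTorsor_of_negCompat
    (hneg : ∀ v, ∃ a : K.model v ≅ K.model v, K.labMap v a = labNeg (K.isLocal_model v) ∧
      ∃ b ∈ Ex63.lifts K (FlPM.mk 0 (-1)), a.hom ≫ K.phiEll v = K.phiEll v ≫ (K.atV v).map b.hom)
    (B₁ B₂ : K.DThetaEllBridge) : IsoTorsor B₁ B₂ :=
  isoTorsor_of_equivariant (fun _ hγ => Ex63.equivariant_of_negCompat hneg hγ) B₁ B₂

/-- **[IUTchI] Prop 6.6 (iii) — PROVED** given the `[−1]`-compatibility of `φ^{Θell}_{•,v}`.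
[claim: Mochizuki2012, status: disputed] -/
theorem DThetaPMEllHT.isoTorsor_of_negCompat
    (hneg : ∀ v, ∃ a : K.model v ≅ K.model v, K.labMap v a = labNeg (K.isLocal_model v) ∧
      ∃ b ∈ Ex63.lifts K (FlPM.mk 0 (-1)), a.hom ≫ K.phiEll v = K.phiEll v ≫ (K.atV v).map b.hom)
    (H₁ H₂ : K.DThetaPMEllHT) : IsoTorsor H₁ H₂ :=
  isoTorsor_of_equivariant (fun _ hγ => Ex63.equivariant_of_negCompat hneg hγ) H₁ H₂

/-- **[IUTchI] Prop 6.8 (i) — PROVED** given the `[−1]`-compatibility of `φ^{Θell}_{•,v}`.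
[claim: Mochizuki2012, status: disputed] -/
theorem DThetaPMEllHT.ellBridgeSymmetry_of_negCompat
    (hneg : ∀ v, ∃ a : K.model v ≅ K.model v, K.labMap v a = labNeg (K.isLocal_model v) ∧
      ∃ b ∈ Ex63.lifts K (FlPM.mk 0 (-1)), a.hom ≫ K.phiEll v = K.phiEll v ≫ (K.atV v).map b.hom)
    (H : K.DThetaPMEllHT) : EllBridgeSymmetry H :=
  ellBridgeSymmetry_of_equivariant (fun _ hγ => Ex63.equivariant_of_negCompat hneg hγ) H

end PMBaseKit

end Literature.IUT.HodgeTheaters
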